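import Mathlib
import Summits.Ventures.PercRepro2.Defs
import Summits.Ventures.PercRepro2.Independence
import Summits.Ventures.PercRepro2.Harris
import Summits.Ventures.PercRepro2.Graph
import Summits.Ventures.PercRepro2.Events
import Summits.Ventures.PercRepro2.ZCDismantle

/-!
# The dismantling theorem at work, II: graphs found by the dismantler
(blind cell PercRepro2, mine-a g25; MINE-A.md §73)

Three instances of `zc_of_dismantling_all'` (ZCDismantle) whose record lists were produced by the
dismantler `dismantle.py` (data/mine-a/g25/codes): the kernel class of (ZC) — every cell (graph, marks)
that can be stripped to nothing by leaves and the four degree-two insertions E, F, G, H — decided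
by a memoised search over (stripped vertices, current marks).  The coverage census of that class over
the cell's connected-graph lists is in MINE-A.md §73 (n = 7: 24,190 of the 179,130 ordered-mark cells).
All side conditions by `decide`; no definition; one seat.
-/

namespace Summit.Ventures.PercRepro2

/-- **(ZC) on a 7-vertex, 11-edge graph** (the engine's `c7_00355`: edges `{0,1} {0,2} {1,3} {1,5} {2,5} {2,6} {3,4} {3,6} {4,5} {4,6} {5,6}`, five independent cycles) with the marks `(0, 2, 3)`, by the dismantling theorem with ALL FIVE record kinds: F at `0` (`w = 1`), H at `1` (`w = 5`), E at `2` (`w = 6`), F at `5` (`w = 4`), G at `3` (`w = 6`), leaf `4` at `6` — the record list found by the dismantler `dismantle.py` (data/mine-a/g25/codes), every side condition by `decide`. -/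
theorem zc_seven_eleven {R : Type*} [CommRing R] [LinearOrder R] [IsStrictOrderedRing R]
    {p : Fin 11 → R} (hp : IsProbVec p) {𝓔 : Set (Set (Fin 7))} (h𝓔 : IsUpperSet 𝓔) :
    let ends : Fin 11 → Sym2 (Fin 7) := ![s(0, 1), s(0, 2), s(1, 3), s(1, 5), s(2, 5), s(2, 6), s(3, 4), s(3, 6), s(4, 5), s(4, 6), s(5, 6)]
    let e := connEvent ends 0 2
    let L' := connEvent ends 0 3
    let U := clusterInEvent ends 0 𝓔
    let γ := connEvent ends 2 3
    0 ≤ prob p (eᶜ ∩ L'ᶜ ∩ γᶜ) * (prob p (U ∩ (e ∩ L')) - prob p U * prob p (e ∩ L'))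
      - prob p (eᶜ ∩ L'ᶜ ∩ γ) * (prob p (U ∩ (e ∩ L'ᶜ)) - prob p U * prob p (e ∩ L'ᶜ)) := by
  intro ends e L' U γ
  have h := zc_of_dismantling_all' (ends := ends)
    [((1 : Fin 5), (1 : Fin 11), (0 : Fin 11), (0 : Fin 7), (1 : Fin 7), (0 : Fin 7), (2 : Fin 7), (3 : Fin 7)),
     (3, 2, 3, 1, 5, 1, 2, 3),
     (0, 4, 5, 2, 6, 5, 2, 3),
     (1, 10, 8, 5, 4, 5, 6, 3),
     (2, 6, 7, 3, 6, 4, 6, 3),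
     (4, 9, 9, 4, 6, 4, 6, 6)]
    (by decide) (by decide) (by decide) p hp
    (by intro e _; fin_cases e <;> decide)
    (0, 2, 3) (by intro r hr; simp at hr; rw [← hr]) h𝓔
  simpa using h

/-- **(ZC) on the `2 × 3` grid** `0 — 1 — 2` over `3 — 4 — 5` (rungs `{0,3} {1,4} {2,5}`) with the marks `(0, 1, 2)` (a row of the grid): F at `0`, leaf `3` at `4`, E at `1` (`w = 2`), leaf `2` at `5`, leaf `4` at `5` — 84 of the 120 ordered mark placements of this grid are in the kernel class (census data/mine-a/g25). -/
theorem zc_grid_two_three {R : Type*} [CommRing R] [LinearOrder R] [IsStrictOrderedRing R]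
    {p : Fin 7 → R} (hp : IsProbVec p) {𝓔 : Set (Set (Fin 6))} (h𝓔 : IsUpperSet 𝓔) :
    let ends : Fin 7 → Sym2 (Fin 6) := ![s(0, 1), s(1, 2), s(3, 4), s(4, 5), s(0, 3), s(1, 4), s(2, 5)]
    let e := connEvent ends 0 1
    let L' := connEvent ends 0 2
    let U := clusterInEvent ends 0 𝓔
    let γ := connEvent ends 1 2
    0 ≤ prob p (eᶜ ∩ L'ᶜ ∩ γᶜ) * (prob p (U ∩ (e ∩ L')) - prob p U * prob p (e ∩ L'))
      - prob p (eᶜ ∩ L'ᶜ ∩ γ) * (prob p (U ∩ (e ∩ L'ᶜ)) - prob p U * prob p (e ∩ L'ᶜ)) := by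
  intro ends e L' U γ
  have h := zc_of_dismantling_all' (ends := ends)
    [((1 : Fin 5), (0 : Fin 7), (4 : Fin 7), (0 : Fin 6), (3 : Fin 6), (0 : Fin 6), (1 : Fin 6), (2 : Fin 6)),
     (4, 2, 2, 3, 4, 3, 1, 2),
     (0, 5, 1, 1, 2, 4, 1, 2),
     (4, 6, 6, 2, 5, 4, 2, 2),
     (4, 3, 3, 4, 5, 4, 5, 2)]
    (by decide) (by decide) (by decide) p hp
    (by intro e _; fin_cases e <;> decide)
    (0, 1, 2) (by intro r hr; simp at hr; rw [← hr]) h𝓔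
  simpa using h

/-- **(ZC) on the 7-vertex, 9-edge graph** `c7_00161` (edges `{0,3} {1,4} {1,5} {2,3} {2,6} {3,6} {4,5} {4,6} {5,6}`) with the marks `(2, 3, 4)`: F at `2`, E at `3` (`w = 0`), H at `6`, G at `4`, leaf `1` at `5`. -/
theorem zc_seven_nine {R : Type*} [CommRing R] [LinearOrder R] [IsStrictOrderedRing R]
    {p : Fin 9 → R} (hp : IsProbVec p) {𝓔 : Set (Set (Fin 7))} (h𝓔 : IsUpperSet 𝓔) :
    let ends : Fin 9 → Sym2 (Fin 7) := ![s(0, 3), s(1, 4), s(1, 5), s(2, 3), s(2, 6), s(3, 6), s(4, 5), s(4, 6), s(5, 6)]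
    let e := connEvent ends 2 3
    let L' := connEvent ends 2 4
    let U := clusterInEvent ends 2 𝓔
    let γ := connEvent ends 3 4
    0 ≤ prob p (eᶜ ∩ L'ᶜ ∩ γᶜ) * (prob p (U ∩ (e ∩ L')) - prob p U * prob p (e ∩ L'))
      - prob p (eᶜ ∩ L'ᶜ ∩ γ) * (prob p (U ∩ (e ∩ L'ᶜ)) - prob p U * prob p (e ∩ L'ᶜ)) := by
  intro ends e L' U γ
  have h := zc_of_dismantling_all' (ends := ends)
    [((1 : Fin 5), (3 : Fin 9), (4 : Fin 9), (2 : Fin 7), (6 : Fin 7), (2 : Fin 7), (3 : Fin 7), (4 : Fin 7)),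
     (0, 5, 0, 3, 0, 6, 3, 4),
     (3, 7, 8, 6, 5, 6, 0, 4),
     (2, 6, 1, 4, 1, 5, 0, 4),
     (4, 2, 2, 1, 5, 5, 0, 1)]
    (by decide) (by decide) (by decide) p hp
    (by intro e _; fin_cases e <;> decide)
    (2, 3, 4) (by intro r hr; simp at hr; rw [← hr]) h𝓔
  simpa using h

end Summit.Ventures.PercRepro2
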